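import Mathlib
import HarnessLib
import Literature.Combinatorics.SimpleGraph.LasserreStableBound
import Literature.Combinatorics.SimpleGraph.LasserreLevelOne
import Literature.Combinatorics.SimpleGraph.LovaszThetaComplement
import Summits.PneNP.PneNP.Theses.RamseyUncertifiable
import Summits.PneNP.PneNP.Theorems.RamseyUncertifiableSosUncertaintyConditioningDefs
import Summits.PneNP.PneNP.Theorems.RamseyUncertifiableSosUncertaintyConditioning

/-!
# Route `RamseyUncertifiable`, item `SosUncertainty` (stmt-PneNP-9815) — the conditioning
# certificate `condCert` is a valid fixed-level certificate

For a finite graph `G` and a level `s ≥ 1` the **conditioning certificate** is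
`condCert G s = max(α(G), (s − 1) + max_{S stable (s−1)-set} ϑ(G[N̄(S)]))`
(`RamseyUncertifiableSosUncertaintyConditioningDefs.lean`), the bound on Laurent's `las_s(G)` produced
by the natural strategy "condition on the `s − 1` vertices of a stable set, then use `ϑ`". This file
proves, sorry-free:

* book-keeping (`indepNum_le_condCert`, `sub_one_le_condCert`, `condCert_nonneg`,
  `sub_one_add_theta_le_condCert`, `condCert_congr`);
* the **key inequality** `one_add_condCert_induce_le`: for `X ⊆ N̄(u₀)`,
  `1 + condCert (G[X]) s ≤ condCert G (s + 1)` — a stable `(s−1)`-set `T` of `G[X]` lifts to the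
  stable `s`-set `insert u₀ T` of `G`, whose link `G[N̄(insert u₀ T)]` contains the link of `T` inside
  `G[X]` (so `ϑ` can only grow, `lovaszTheta_comap_le`), and `α(G[X]) + 1 ≤ α(G)`;
* `lovaszTheta_le_condCert_one` (`ϑ(G) ≤ condCert G 1`, the link of `∅` is all of `G`), and
* `lasserreStableBound_le_condCert`: **`las_s(G) ≤ condCert G s` for every `s ≥ 1` and every finite
  graph** — by induction on `s` with the conditioning recursion `conditioning_recursion`
  (`las_{s+1}(G) ≤ 1 + max_u las_s(G[N̄ u])`, `RamseyUncertifiableSosUncertaintyConditioning.lean`)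
  and the key inequality with `X = N̄(u)`.

The companion file `RamseyUncertifiableSosUncertaintyConditioningUncertainty.lean` proves that this
certificate obeys an uncertainty principle with exponent `1/s` on EVERY graph, so it can never
refute `UP_s`. [folklore]
-/

-- the Theorems namespace `Summit.PneNP.PneNP.Theorems` is prescribed by the tree layout
set_option linter.dupNamespace false

noncomputable section

namespace Summit.PneNP.PneNP.Theorems.SosUncertainty

open Literature.Combinatorics.SimpleGraph Finset Matrix

section Basics

variable {V : Type} [Fintype V] [DecidableEq V] (G : SimpleGraph V) [DecidableRel G.Adj]

/-- The family of link thetas indexing the inner supremum of `condCert G s`. -/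
theorem condCert_img_finite (s : ℕ) :
    ((fun S : Finset V => lovaszTheta (G.induce {v : V | ∀ a ∈ S, Gᶜ.Adj a v})) ''
      {S : Finset V | G.IsNIndepSet (s - 1) S}).Finite :=
  (Set.toFinite _).image _

/-- Every link theta is nonnegative. -/
theorem condCert_img_nonneg (s : ℕ) :
    ∀ x ∈ ((fun S : Finset V => lovaszTheta (G.induce {v : V | ∀ a ∈ S, Gᶜ.Adj a v})) ''
      {S : Finset V | G.IsNIndepSet (s - 1) S}), 0 ≤ x := by
  rintro _ ⟨S, _, rfl⟩
  exact lovaszTheta_nonneg _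

/-- The inner supremum is nonnegative (empty family: `sSup ∅ = 0`). -/
theorem condCert_sSup_nonneg (s : ℕ) :
    0 ≤ sSup ((fun S : Finset V => lovaszTheta (G.induce {v : V | ∀ a ∈ S, Gᶜ.Adj a v})) ''
      {S : Finset V | G.IsNIndepSet (s - 1) S}) :=
  Real.sSup_nonneg (condCert_img_nonneg G s)

/-- `α(G) ≤ condCert G s`. -/
theorem indepNum_le_condCert (s : ℕ) : (G.indepNum : ℝ) ≤ condCert G s := le_max_left _ _

/-- `s − 1 ≤ condCert G s`. -/
theorem sub_one_le_condCert (s : ℕ) : ((s - 1 : ℕ) : ℝ) ≤ condCert G s :=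
  (le_add_of_nonneg_right (condCert_sSup_nonneg G s)).trans (le_max_right _ _)

/-- `0 ≤ condCert G s`. -/
theorem condCert_nonneg (s : ℕ) : 0 ≤ condCert G s :=
  (Nat.cast_nonneg _).trans (indepNum_le_condCert G s)

/-- A link theta is at most the inner supremum. -/
theorem theta_le_condCert_sSup (s : ℕ) {S : Finset V} (hS : G.IsNIndepSet (s - 1) S) :
    lovaszTheta (G.induce {v : V | ∀ a ∈ S, Gᶜ.Adj a v}) ≤
      sSup ((fun S : Finset V => lovaszTheta (G.induce {v : V | ∀ a ∈ S, Gᶜ.Adj a v})) ''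
        {S : Finset V | G.IsNIndepSet (s - 1) S}) :=
  le_csSup (condCert_img_finite G s).bddAbove ⟨S, hS, rfl⟩

/-- A stable `(s−1)`-set `S` witnesses `(s − 1) + ϑ(G[N̄ S]) ≤ condCert G s`. -/
theorem sub_one_add_theta_le_condCert (s : ℕ) {S : Finset V} (hS : G.IsNIndepSet (s - 1) S) :
    ((s - 1 : ℕ) : ℝ) + lovaszTheta (G.induce {v : V | ∀ a ∈ S, Gᶜ.Adj a v}) ≤ condCert G s := by
  have h := theta_le_condCert_sSup G s hS
  unfold condCert
  refine le_trans ?_ (le_max_right _ _)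
  linarith

omit [Fintype V] [DecidableEq V] [DecidableRel G.Adj] in
/-- `condCert` does not depend on the decidability instance / transports along graph equality. -/
theorem condCert_congr {G₁ G₂ : SimpleGraph V} [Fintype V] [DecidableEq V] [DecidableRel G₁.Adj]
    [DecidableRel G₂.Adj] (h : G₁ = G₂) (s : ℕ) : condCert G₁ s = condCert G₂ s := by
  subst h
  congr!

end Basics

/-! ### Lifting stable sets from an induced subgraph below a non-neighbourhood -/

section Lift

variable {V : Type} [Fintype V] [DecidableEq V] (G : SimpleGraph V) [DecidableRel G.Adj]
  (X : Set V) [Fintype X] [DecidablePred (· ∈ X)] (u₀ : V) (hX : X ⊆ Gᶜ.neighborSet u₀)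

include hX in
omit [Fintype V] [Fintype X] [DecidablePred (· ∈ X)] [DecidableRel G.Adj] in
/-- A stable set `T` of `G[X]`, `X ⊆ N̄(u₀)`, lifts to the stable set `insert u₀ T` of `G`. -/
theorem isIndepSet_insert_map {T : Finset X} (hT : (G.induce X).IsIndepSet (T : Set X)) :
    G.IsIndepSet ((insert u₀ (T.map (Function.Embedding.subtype _)) : Finset V) : Set V) := by
  intro a ha b hb hab
  rw [mem_coe, mem_insert, mem_map] at ha hb
  have key : ∀ x : X, ¬ G.Adj u₀ x.1 ∧ u₀ ≠ x.1 := fun x => by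
    have h := hX x.2
    rw [SimpleGraph.mem_neighborSet, SimpleGraph.compl_adj] at h
    exact ⟨h.2, h.1⟩
  rcases ha with rfl | ⟨x, hx, rfl⟩ <;> rcases hb with rfl | ⟨y, hy, rfl⟩
  · exact absurd rfl hab
  · exact (key y).1
  · exact fun h => (key x).1 h.symm
  · intro h
    have hxy : x ≠ y := fun hxy => hab (by rw [hxy])
    exact hT (mem_coe.2 hx) (mem_coe.2 hy) hxy h

include hX in
omit [Fintype V] [Fintype X] [DecidablePred (· ∈ X)] [DecidableRel G.Adj] in
/-- `u₀ ∉ X`, so the lift has one more element. -/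
theorem card_insert_map (T : Finset X) :
    (insert u₀ (T.map (Function.Embedding.subtype _)) : Finset V).card = T.card + 1 := by
  rw [card_insert_of_notMem, card_map]
  intro hu
  rw [mem_map] at hu
  obtain ⟨x, _, hx⟩ := hu
  have h := hX x.2
  rw [SimpleGraph.mem_neighborSet] at h
  rw [Function.Embedding.coe_subtype] at hx
  rw [hx] at h
  exact h.ne rfl

include hX in
omit [Fintype V] [Fintype X] [DecidablePred (· ∈ X)] [DecidableRel G.Adj] in
/-- The lift of a stable `k`-set of `G[X]` is a stable `(k+1)`-set of `G`. -/
theorem isNIndepSet_insert_map {k : ℕ} {T : Finset X} (hT : (G.induce X).IsNIndepSet k T) :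
    G.IsNIndepSet (k + 1) (insert u₀ (T.map (Function.Embedding.subtype _))) :=
  ⟨isIndepSet_insert_map G X u₀ hX hT.1, by rw [card_insert_map G X u₀ hX, hT.2]⟩

include hX in
omit [DecidablePred (· ∈ X)] [DecidableRel G.Adj] [Fintype X] in
/-- `α(G[X]) + 1 ≤ α(G)` when `X ⊆ N̄(u₀)`. -/
theorem indepNum_induce_succ_le : (G.induce X).indepNum + 1 ≤ G.indepNum := by
  obtain ⟨T, hT⟩ := (G.induce X).exists_isNIndepSet_indepNum
  have h := (isNIndepSet_insert_map G X u₀ hX hT)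
  have := h.1.card_le_indepNum
  rwa [h.2] at this

include hX in
omit [Fintype V] [Fintype X] [DecidablePred (· ∈ X)] [DecidableRel G.Adj] in
/-- The link of the lifted set contains the link computed inside `G[X]`:
for `x ∈ X` with `∀ a ∈ T, G[X]ᶜ.Adj a x` one has `∀ a ∈ insert u₀ T, Gᶜ.Adj a x`. -/
theorem mem_link_of_mem_link_induce {T : Finset X} {x : X}
    (hx : ∀ a ∈ T, (G.induce X)ᶜ.Adj a x) :
    ∀ a ∈ (insert u₀ (T.map (Function.Embedding.subtype _)) : Finset V), Gᶜ.Adj a x.1 := by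
  intro a ha
  rw [mem_insert, mem_map] at ha
  rcases ha with rfl | ⟨y, hy, rfl⟩
  · exact hX x.2
  · have h := hx y hy
    rw [SimpleGraph.compl_adj] at h ⊢
    refine ⟨fun hyx => h.1 (Subtype.ext hyx), fun hadj => h.2 ?_⟩
    exact hadj

end Lift

/-! ### The key inequality -/

section Key

variable {V : Type} [Fintype V] [DecidableEq V] (G : SimpleGraph V) [DecidableRel G.Adj]

/-- **Key lemma.** For `X ⊆ N̄(u₀)` and `s ≥ 1`: `1 + condCert (G.induce X) s ≤ condCert G (s + 1)`
(every stable `(s−1)`-set of `G[X]` lifts by `u₀` to a stable `s`-set of `G` whose link contains the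
link inside `G[X]`, and `α(G[X]) + 1 ≤ α(G)`). -/
theorem one_add_condCert_induce_le (X : Set V) [Fintype X] [DecidablePred (· ∈ X)] (u₀ : V)
    (hX : X ⊆ Gᶜ.neighborSet u₀) {s : ℕ} (hs : 1 ≤ s) :
    1 + condCert (G.induce X) s ≤ condCert G (s + 1) := by
  rw [condCert, ← max_add_add_left]
  refine max_le ?_ ?_
  · -- the `α` branch
    have h := indepNum_induce_succ_le G X u₀ hX
    have h' : (1 : ℝ) + ((G.induce X).indepNum : ℝ) ≤ (G.indepNum : ℝ) := by
      rw [add_comm]; exact_mod_cast h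
    exact h'.trans (indepNum_le_condCert G (s + 1))
  · -- the link branch
    rw [condCert]
    refine le_trans ?_ (le_max_right _ _)
    have hs1 : (1 : ℝ) + ((s - 1 : ℕ) : ℝ) = ((s + 1 - 1 : ℕ) : ℝ) := by
      rw [Nat.add_sub_cancel]
      have : (s - 1 : ℕ) + 1 = s := Nat.sub_add_cancel hs
      rw [add_comm]; exact_mod_cast this
    rw [← add_assoc, hs1]
    refine add_le_add le_rfl ?_
    refine Real.sSup_le ?_ (condCert_sSup_nonneg G (s + 1))
    rintro _ ⟨T, hT, rfl⟩
    -- `T` a stable `(s-1)`-set of `G[X]`; lift it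
    have hT' : G.IsNIndepSet (s + 1 - 1) (insert u₀ (T.map (Function.Embedding.subtype _))) := by
      rw [Nat.add_sub_cancel]
      have h := isNIndepSet_insert_map G X u₀ hX hT
      rwa [Nat.sub_add_cancel hs] at h
    refine le_trans ?_ (theta_le_condCert_sSup G (s + 1) hT')
    dsimp only
    -- monotonicity of `ϑ` along the inclusion of links
    let j : {x : X | ∀ a ∈ T, (G.induce X)ᶜ.Adj a x} →
        {v : V | ∀ a ∈ (insert u₀ (T.map (Function.Embedding.subtype _)) : Finset V), Gᶜ.Adj a v} :=
      fun x => ⟨x.1.1, mem_link_of_mem_link_induce G X u₀ hX x.2⟩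
    have hj : Function.Injective j := fun x y h => by
      apply Subtype.ext; apply Subtype.ext
      exact congrArg (fun z : {v : V | ∀ a ∈ (insert u₀ (T.map (Function.Embedding.subtype _)) :
        Finset V), Gᶜ.Adj a v} => z.1) h
    have hG : (G.induce X).induce {x : X | ∀ a ∈ T, (G.induce X)ᶜ.Adj a x} =
        (G.induce {v : V | ∀ a ∈ (insert u₀ (T.map (Function.Embedding.subtype _)) : Finset V),
          Gᶜ.Adj a v}).comap j := by
      ext a b; rfl
    rw [hG]
    exact lovaszTheta_comap_le _ hj

/-- The whole non-neighbourhood: `1 + condCert (G[N̄ u]) s ≤ condCert G (s+1)`. -/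
theorem one_add_condCert_link_le (u : V) {s : ℕ} (hs : 1 ≤ s) :
    1 + condCert (G.induce (Gᶜ.neighborSet u)) s ≤ condCert G (s + 1) :=
  one_add_condCert_induce_le G (Gᶜ.neighborSet u) u subset_rfl hs

end Key

/-! ### Level one, and the certificate bounds `las_s` -/

section UpperBound

variable {V : Type} [Fintype V] [DecidableEq V] (G : SimpleGraph V) [DecidableRel G.Adj]

/-- `ϑ(G) ≤ condCert G 1` (in fact equality): the only stable `0`-set is `∅`, whose link is all of `G`. -/
theorem lovaszTheta_le_condCert_one : lovaszTheta G ≤ condCert G 1 := by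
  have h0 : G.IsNIndepSet (1 - 1) (∅ : Finset V) := ⟨by simp, by simp⟩
  refine le_trans ?_ (sub_one_add_theta_le_condCert G 1 h0)
  simp only [Nat.sub_self, Nat.cast_zero, zero_add]
  -- `G` embeds into (is isomorphic to) the graph induced on `{v | ∀ a ∈ ∅, Gᶜ.Adj a v} = univ`
  let φ : G ↪g G.induce {v : V | ∀ a ∈ (∅ : Finset V), Gᶜ.Adj a v} :=
    { toFun := fun v => ⟨v, by simp⟩
      inj' := fun v w h => congrArg Subtype.val h
      map_rel_iff' := Iff.rfl }
  exact lovaszTheta_le_of_embedding φ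

/-- **The conditioning certificate is a certificate**: `las_s(G) ≤ condCert G s` for `s ≥ 1` and
every finite graph (iterated conditioning recursion, `conditioning_recursion`, down to level `1`,
where `las₁ = ϑ`). -/
theorem lasserreStableBound_le_condCert :
    ∀ (s : ℕ), 1 ≤ s → ∀ {W : Type} [Fintype W] [DecidableEq W] (H : SimpleGraph W)
      [DecidableRel H.Adj], lasserreStableBound H s ≤ condCert H s := by
  intro s hs
  induction s, hs using Nat.le_induction with
  | base =>
    intro W _ _ H _
    rw [lasserreStableBound_one_eq_lovaszTheta]
    exact lovaszTheta_le_condCert_one H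
  | succ s hs ih =>
    intro W _ _ H _
    rcases isEmpty_or_nonempty W with hW | hW
    · -- no vertices: `las = 0`
      refine (lasserreStableBound_le_of_forall fun y _ => ?_).trans (condCert_nonneg H (s + 1))
      simp
    · have hM : ∀ u : W, lasserreStableBound (H.induce (Hᶜ.neighborSet u)) s ≤
          condCert H (s + 1) - 1 := fun u => by
        have h1 := ih (H.induce (Hᶜ.neighborSet u))
        have h2 := one_add_condCert_link_le H u hs
        linarith
      have h := conditioning_recursion H hs hM
      linarith

end UpperBound

end Summit.PneNP.PneNP.Theorems.SosUncertainty

end
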